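import Mathlib.Data.Finsupp.Fin
import Literature.Barriers.ValiantsHypothesis.BDGIL24HomogeneousComponents
import Literature.Computability.AlgebraicComplexity.IMMInVPProofs
import HarnessLib

/-!
# van den Berg–Dutta–Gesmundo–Ikenmeyer–Lysikov 2024, Remark 1.3: lifting to the
# non-homogeneous setting (degree-`d` homogenisation of polynomials AND of metapolynomials)

M. van den Berg, P. Dutta, F. Gesmundo, C. Ikenmeyer, V. Lysikov, *Algebraic metacomplexity and
representation theory*, arXiv:2411.03444 [BergEtAl2024], Remark 1.3 (printed p.5, PDF p.6; held
text `paper:arxiv-2411.03444` p0006.txt:L32–L48), TYPED AND PROVED: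

> "In general, algebraic complexity classes are defined for possibly non-homogeneous polynomials.
> In this paper, we assume that polynomials and metapolynomials are homogeneous. However, one can
> lift the results to the nonhomogeneous setting as follows. […] For `d ≥ deg(f)`, define the
> degree `d` homogenization `f♯d(x₀, x₁, …, x_k) := x₀^d f(x₁/x₀, …, x_k/x₀)`. If `f` has an
> algebraic circuit of size `s`, then `f♯d` has an algebraic circuit of size at most `O(sd)`:
> `s(d + 1)` for extracting the homogeneous parts of `f` via interpolation, `d` operations to
> compute all values `x₀, x₀², …, x₀^d`, and another `d + 1` for multiplying the homogeneous
> components with the correct powers of `x₀`, and a final `d` for adding up the results. Given a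
> metapolynomial `Δ` that does not involve `x₀`, define `Δ♯d` by replacing every metavariable `cᵢ`
> with `c_{i + (d − |i|, 0, 0, …)}`, and setting every metavariable `cᵢ` with `|i| > d` to zero.
> Clearly we have `Δ♯d(f♯d) = Δ(f)`, provided that `d ≥ deg(f)`. Hence, in this paper we can
> always assume that `f` is homogeneous."

## What is here (two bodied definitions, everything else proved; no named facts)

* `degHomogenize d f` — **`f♯d`**, for `f ∈ R[x₁,…,x_k]` (tree indices `Fin k`) the polynomial
  `Σ_{e ≤ d} x₀^{d-e} · f^{(e)}(x₁,…,x_k) ∈ R[x₀,…,x_k]` (indices `Fin (k + 1)`, the new variable is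
  `0`, `xᵢ ↦ x_{Fin.succ i}`); `isHomogeneous_degHomogenize` (homogeneous of degree `d`),
  `coeff_cons_degHomogenize` (the coefficient of `x₀^a x^i` is `[a + |i| = d] · coeff_i f`),
  `aeval_cons_one_X_degHomogenize` (`f♯d(1, x) = f` for `deg f ≤ d`, i.e. dehomogenisation
  recovers `f`; cf. the tree's existential `Literature.AlgebraicGeometry.Motives.ProjectiveSpace.
  exists_isHomogeneous_dehomogenize_eq`, whose witness at the chart `i = 0` is this polynomial),
  `eval_cons_degHomogenize` and **`eval_cons_degHomogenize_eq_pow_mul`: `f♯d(t, y) = t^d · f(y/t)`**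
  (`t ≠ 0`, `deg f ≤ d`) — the printed definition.
* **The circuit bound** ("size at most `O(sd)`"): `degHomogenize_eq_sum_interpolation` — with
  `d + 1` distinct nodes `λ_j` and `V = (λ_j^e)` the Vandermonde matrix,
  `f♯d = Σ_j μ_j(x₀) · f(λ_j x)` where `μ_j(x₀) = Σ_e (V⁻¹)_{e j} x₀^{d-e}` (the printed route:
  homogeneous parts by interpolation, powers of `x₀`, products, sum — regrouped so that each of the
  `d + 1` rescaled copies of `f` is used once); hence
  **`complexity_degHomogenize_le`: `L(f♯d) ≤ (d + 1) · (L(f) + k + 2d + 2)`** for the tree's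
  fan-in-two gate count `complexity` (Bürgisser's `L`), and
  **`affComplexity_degHomogenize_le`: `cc(f♯d) ≤ (d + 1) · (cc(f) + 2d + 2)`** for the paper's
  size `cc` with affine-linear input gates free (`BergEtAl2024.affComplexity`, §2.1). CONSTANTS:
  the print books `s(d+1) + d + (d+1) + d`; the tree's counts book in addition, per copy, the `k`
  input rescalings `λ_j xᵢ` (free for `cc`, one gate each for `L`) and the `≤ 2d` gates of a Horner
  evaluation of the interpolation polynomial `μ_j` (the print does not book the interpolation's own
  linear algebra; same convention as `affComplexity_homogeneousComponent_le` in
  `BDGIL24HomogeneousComponents.lean`). Same `O(sd)` for `s ≥ d, k`; disclosed, not a weakening of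
  the method.
* `metaHomogenize d Δ` — **`Δ♯d`**, for a metapolynomial `Δ ∈ F[c_i : i ∈ M]` on ANY set `M` of
  exponent vectors `i ∈ ℕ^k` (the frame of the tree's FSV/GKSS natural-proofs files:
  `Δ(f) = eval (coeffVector M f) Δ`, `AlgebraicNaturalProofs.lean`; e.g. `M = degLEMonomials n`),
  the metapolynomial of format `(·, d, k + 1)` (`MvPolynomial (DegIdx (Fin (k + 1)) d) F`, the
  BDGIL24 frame: `Δ'(g) = eval (formCoeff d g) Δ'`) obtained by `c_i ↦ c_{(d - |i|, i)}` for
  `|i| ≤ d` and `c_i ↦ 0` for `|i| > d`; it is an algebra map, preserves homogeneity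
  (`isHomogeneous_metaHomogenize`), does not increase either size measure
  (`complexity_metaHomogenize_le`, `affComplexity_metaHomogenize_le`), is injective when
  `M ⊆ {|i| ≤ d}` (`metaHomogenize_injective`), and
  **`eval_metaHomogenize_degHomogenize`: `Δ♯d(f♯d) = Δ(f)` provided `d ≥ deg f`** (for
  `M ⊆ {|i| ≤ d}` the degree proviso is not needed: `eval_metaHomogenize_degHomogenize_of_subset`).
* Transfer ("hence we can always assume that `f` is homogeneous"): `metaHomogenize_vanishes_image`
  / `eval_metaHomogenize_ne_zero` and `isNaturalProof_metaHomogenize` — an FSV natural proof `D`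
  (`IsNaturalProof M 𝒞 𝒟 D`, `AlgebraicNaturalProofs.lean`) against a class `𝒞` of polynomials of
  degree `≤ d` yields the HOMOGENEOUS-format metapolynomial `D♯d`, of no larger size, vanishing on
  the class `f♯d '' 𝒞` of degree-`d` FORMS (whose circuit sizes grew by the factor above) and
  non-vanishing wherever `D` was.

Conventions: the index bijection `i ↦ (d - |i|, i)` between monomials of degree `≤ d` in `k`
variables and monomials of degree `d` in `k + 1` variables is the tree's
`GKSS2017.degLEEquivHom` (`GKSS17FSVPresentation.lean`, not imported); here it is spelt
`Finsupp.cons (d - i.degree) i` into the BDGIL24 index type `DegIdx (Fin (k + 1)) d`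
(`degMonomials`, `OrbitCoordinateRing.lean`). Polynomial identities over a commutative
(semi)ring `R`/`F`; the circuit bounds over `ℂ` (the paper's field; `affComplexity` is typed
over `ℂ`). Honest framing: a bookkeeping remark; nothing here bears on `VP ≠ VNP`.

## References
* [BergEtAl2024] arXiv:2411.03444, Remark 1.3, p.5 (PDF p.6; p0006.txt:L32–L48); §2.1 p.6
  (PDF p.7) for `cc`.

## Mathlib and tree
Mathlib: `MvPolynomial.homogeneousComponent`, `Finsupp.cons`/`Finsupp.tail`,
`MvPolynomial.coeff_rename_mapDomain`, `MvPolynomial.IsHomogeneous.aeval`, `Matrix.vandermonde`.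
Tree: `BDGIL24HomogeneousComponents` (`aeval_C_mul_X_of_isHomogeneous`, `nodes_injective`,
`eval_smul_eq_sum_homogeneousComponent`), `BDGIL24WeightProjectionProofs`
(`vandermonde_inv_mul_pow`, `affComplexity_add_le`, `affComplexity_aeval_le_of_forall_le_one`,
`exists_presentation_affComplexity`), `ArithCircuitProofs` (`complexity_*_holds`,
`complexity_finset_sum_le`), `IMMInVPProofs.complexity_aeval_le`, `AlgebraicNaturalProofs`
(`coeffVector`, `IsNaturalProof`), `OrbitCoordinateRing` (`DegIdx`, `formCoeff`).
-/

noncomputable section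

open MvPolynomial
open Literature.Computability.AlgebraicComplexity

namespace Literature.Barriers.ValiantsHypothesis

namespace BergEtAl2024

/-! ### Exponent vectors: `(a, i) = Finsupp.cons a i` -/

section Finsupp

variable {k : ℕ}

/-- `|(a, i)| = a + |i|`. [folklore] -/
private theorem degree_cons (a : ℕ) (i : Fin k →₀ ℕ) :
    (Finsupp.cons a i).degree = a + i.degree := by
  rw [Finsupp.degree_eq_sum, Fin.sum_univ_succ, Finsupp.cons_zero, Finsupp.degree_eq_sum]
  simp only [Finsupp.cons_succ]

/-- `(0, i)` is `i` moved to the variables `x₁, …, x_k`. [folklore] -/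
private theorem cons_zero_eq_mapDomain (i : Fin k →₀ ℕ) :
    Finsupp.cons 0 i = i.mapDomain Fin.succ := by
  ext j
  refine Fin.cases ?_ (fun j => ?_) j
  · rw [Finsupp.cons_zero, Finsupp.mapDomain_notin_range]
    rintro ⟨l, hl⟩
    exact Fin.succ_ne_zero l hl
  · rw [Finsupp.cons_succ, Finsupp.mapDomain_apply (Fin.succ_injective k)]

/-- `(a, i) - (n, 0) = (a - n, i)`. [folklore] -/
private theorem cons_tsub_single (a n : ℕ) (i : Fin k →₀ ℕ) :
    Finsupp.cons a i - Finsupp.single 0 n = Finsupp.cons (a - n) i := by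
  ext j
  refine Fin.cases ?_ (fun j => ?_) j
  · simp [Finsupp.cons_zero]
  · simp [Finsupp.cons_succ, (Fin.succ_ne_zero j)]

/-- The coefficient of `x₀^a x^i` in `x₀^n · g(x₁, …, x_k)` is `[a = n] · coeff_i g` (the
bookkeeping behind "replacing every metavariable `cᵢ` with `c_{i + (d - |i|, 0, …, 0)}`").
[cite: BergEtAl2024, Remark 1.3, p.5 (PDF p.6)] -/
theorem coeff_cons_X_pow_mul_rename {R : Type*} [CommSemiring R] (n a : ℕ) (i : Fin k →₀ ℕ)
    (g : MvPolynomial (Fin k) R) :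
    coeff (Finsupp.cons a i) ((X 0 : MvPolynomial (Fin (k + 1)) R) ^ n * rename Fin.succ g) =
      if a = n then coeff i g else 0 := by
  classical
  rw [X_pow_eq_monomial, coeff_monomial_mul', one_mul]
  have hle : Finsupp.single (0 : Fin (k + 1)) n ≤ Finsupp.cons a i ↔ n ≤ a := by
    rw [Finsupp.single_le_iff, Finsupp.cons_zero]
  by_cases hna : n ≤ a
  · rw [if_pos (hle.mpr hna), cons_tsub_single]
    by_cases han : a = n
    · subst han
      rw [if_pos rfl, Nat.sub_self, cons_zero_eq_mapDomain,
        coeff_rename_mapDomain _ (Fin.succ_injective k)]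
    · rw [if_neg han]
      refine coeff_rename_eq_zero _ _ _ fun u hu => ?_
      exfalso
      have h0 := DFunLike.congr_fun hu 0
      rw [Finsupp.mapDomain_notin_range _ _ (by rintro ⟨l, hl⟩; exact Fin.succ_ne_zero l hl),
        Finsupp.cons_zero] at h0
      omega
  · rw [if_neg (fun h => hna (hle.mp h)), if_neg (by omega)]

end Finsupp

/-! ### `f♯d`: the degree-`d` homogenisation of a polynomial -/

section Poly

variable {R : Type*} [CommSemiring R] {k : ℕ}

/-- **`f♯d`, the degree-`d` homogenisation** of `f ∈ R[x₁, …, x_k]`: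
`f♯d(x₀, x₁, …, x_k) = x₀^d f(x₁/x₀, …, x_k/x₀) = Σ_{e ≤ d} x₀^{d-e} f^{(e)}(x₁, …, x_k)` with
`f^{(e)}` the homogeneous component of degree `e` (intended for `d ≥ deg f`; for `d < deg f` the
components of degree `> d` are dropped). The new variable is `0 : Fin (k + 1)` and `xᵢ` becomes
`x_{Fin.succ i}`. [cite: BergEtAl2024, Remark 1.3, p.5 (PDF p.6)]
locator: paper:arxiv-2411.03444 p0006.txt:L35–L38 -/
def degHomogenize (d : ℕ) (f : MvPolynomial (Fin k) R) : MvPolynomial (Fin (k + 1)) R :=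
  ∑ e ∈ Finset.range (d + 1), X 0 ^ (d - e) * rename Fin.succ (homogeneousComponent e f)

/-- Unfolding `f♯d = Σ_{e ≤ d} x₀^{d-e} f^{(e)}(x₁,…,x_k)`. [cite: BergEtAl2024, Remark 1.3, p.5 (PDF p.6)] -/
theorem degHomogenize_def (d : ℕ) (f : MvPolynomial (Fin k) R) :
    degHomogenize d f =
      ∑ e ∈ Finset.range (d + 1), X 0 ^ (d - e) * rename Fin.succ (homogeneousComponent e f) :=
  rfl

/-- `f ↦ f♯d` is additive. [cite: BergEtAl2024, Remark 1.3, p.5 (PDF p.6)] -/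
theorem degHomogenize_add (d : ℕ) (f g : MvPolynomial (Fin k) R) :
    degHomogenize d (f + g) = degHomogenize d f + degHomogenize d g := by
  simp only [degHomogenize, map_add, mul_add, Finset.sum_add_distrib]

/-- `f ↦ f♯d` commutes with scalars. [cite: BergEtAl2024, Remark 1.3, p.5 (PDF p.6)] -/
theorem degHomogenize_smul (d : ℕ) (c : R) (f : MvPolynomial (Fin k) R) :
    degHomogenize d (c • f) = c • degHomogenize d f := by
  simp only [degHomogenize, map_smul, Finset.smul_sum, mul_smul_comm]

/-- `0♯d = 0`. [cite: BergEtAl2024, Remark 1.3, p.5 (PDF p.6)] -/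
@[simp] theorem degHomogenize_zero (d : ℕ) : degHomogenize d (0 : MvPolynomial (Fin k) R) = 0 := by
  simp [degHomogenize]

/-- **`f♯d` is homogeneous of degree `d`.** [cite: BergEtAl2024, Remark 1.3, p.5 (PDF p.6)]
locator: paper:arxiv-2411.03444 p0006.txt:L35–L38 -/
theorem isHomogeneous_degHomogenize (d : ℕ) (f : MvPolynomial (Fin k) R) :
    (degHomogenize d f).IsHomogeneous d := by
  refine IsHomogeneous.sum _ _ _ fun e he => ?_
  have he' : e ≤ d := Nat.lt_succ_iff.mp (Finset.mem_range.mp he)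
  have h1 : ((X 0 : MvPolynomial (Fin (k + 1)) R) ^ (d - e)).IsHomogeneous (1 * (d - e)) :=
    (isHomogeneous_X R (0 : Fin (k + 1))).pow (d - e)
  have h2 : (rename Fin.succ (homogeneousComponent e f)).IsHomogeneous e :=
    (homogeneousComponent_isHomogeneous e f).rename_isHomogeneous
  have h := h1.mul h2
  rwa [one_mul, Nat.sub_add_cancel he'] at h

/-- **Coefficients of `f♯d`**: the coefficient of `x₀^a · x^i` is `coeff_i f` if `a + |i| = d` and
`0` otherwise. [cite: BergEtAl2024, Remark 1.3, p.5 (PDF p.6)]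
locator: paper:arxiv-2411.03444 p0006.txt:L35–L38 -/
theorem coeff_cons_degHomogenize (d : ℕ) (f : MvPolynomial (Fin k) R) (a : ℕ) (i : Fin k →₀ ℕ) :
    coeff (Finsupp.cons a i) (degHomogenize d f) = if a + i.degree = d then coeff i f else 0 := by
  rw [degHomogenize, coeff_sum]
  simp_rw [coeff_cons_X_pow_mul_rename, coeff_homogeneousComponent]
  by_cases h : a + i.degree = d
  · rw [if_pos h, Finset.sum_eq_single i.degree]
    · rw [if_pos (by omega), if_pos rfl]
    · intro e _ hne
      by_cases hae : a = d - e
      · rw [if_pos hae, if_neg (Ne.symm hne)]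
      · rw [if_neg hae]
    · intro hi
      exfalso
      exact hi (Finset.mem_range.mpr (by omega))
  · rw [if_neg h]
    refine Finset.sum_eq_zero fun e he => ?_
    have he' : e ≤ d := Nat.lt_succ_iff.mp (Finset.mem_range.mp he)
    by_cases hae : a = d - e
    · rw [if_pos hae, if_neg]
      omega
    · rw [if_neg hae]

/-- The coefficient of `x₀^{d-|i|} x^i` in `f♯d` is `coeff_i f` (`|i| ≤ d`): the coefficient map of
`f ↦ f♯d` on exponents is `i ↦ (d - |i|, i)`. [cite: BergEtAl2024, Remark 1.3, p.5 (PDF p.6)]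
locator: paper:arxiv-2411.03444 p0006.txt:L44–L46 -/
theorem coeff_cons_sub_degHomogenize (d : ℕ) (f : MvPolynomial (Fin k) R) {i : Fin k →₀ ℕ}
    (hi : i.degree ≤ d) :
    coeff (Finsupp.cons (d - i.degree) i) (degHomogenize d f) = coeff i f := by
  rw [coeff_cons_degHomogenize, if_pos (Nat.sub_add_cancel hi)]

/-- Every coefficient of `f♯d`, through `m = (m 0, tail m)`. [cite: BergEtAl2024, Remark 1.3, p.5 (PDF p.6)] -/
theorem coeff_degHomogenize (d : ℕ) (f : MvPolynomial (Fin k) R) (m : Fin (k + 1) →₀ ℕ) :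
    coeff m (degHomogenize d f) = if m.degree = d then coeff (Finsupp.tail m) f else 0 := by
  conv_lhs => rw [← Finsupp.cons_tail m]
  rw [coeff_cons_degHomogenize, ← degree_cons, Finsupp.cons_tail]

/-- The homogeneous components of `f` up to any `D ≥ deg f` sum to `f`. [folklore] -/
private theorem sum_range_homogeneousComponent_of_le {σ : Type*} (f : MvPolynomial σ R) {D : ℕ}
    (hD : f.totalDegree ≤ D) :
    ∑ e ∈ Finset.range (D + 1), homogeneousComponent e f = f := by
  rw [← Finset.sum_subset (Finset.range_subset_range.mpr (Nat.succ_le_succ hD))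
    (fun e _ he => homogeneousComponent_eq_zero e f
      (by have := Finset.mem_range.not.mp he; omega))]
  exact sum_homogeneousComponent f

/-- **Dehomogenising `f♯d` gives back `f`**: `f♯d(1, x₁, …, x_k) = f` for `d ≥ deg f`.
[cite: BergEtAl2024, Remark 1.3, p.5 (PDF p.6)] locator: paper:arxiv-2411.03444 p0006.txt:L35–L38 -/
theorem aeval_cons_one_X_degHomogenize {d : ℕ} {f : MvPolynomial (Fin k) R}
    (hf : f.totalDegree ≤ d) :
    aeval (Fin.cons 1 X : Fin (k + 1) → MvPolynomial (Fin k) R) (degHomogenize d f) = f := by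
  rw [degHomogenize, map_sum]
  have hterm : ∀ e ∈ Finset.range (d + 1),
      aeval (Fin.cons 1 X : Fin (k + 1) → MvPolynomial (Fin k) R)
        (X 0 ^ (d - e) * rename Fin.succ (homogeneousComponent e f)) =
      homogeneousComponent e f := fun e _ => by
    rw [map_mul, map_pow, aeval_X, Fin.cons_zero, one_pow, one_mul, aeval_rename]
    have : ((Fin.cons 1 X : Fin (k + 1) → MvPolynomial (Fin k) R) ∘ Fin.succ) = X :=
      funext fun i => Fin.cons_succ _ _ i
    rw [this, aeval_X_left, AlgHom.coe_id, id_eq]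
  rw [Finset.sum_congr rfl hterm]
  exact sum_range_homogeneousComponent_of_le f hf

/-- `f ↦ f♯d` is injective on polynomials of degree `≤ d`.
[cite: BergEtAl2024, Remark 1.3, p.5 (PDF p.6)] -/
theorem degHomogenize_injOn (d : ℕ) :
    Set.InjOn (degHomogenize (R := R) (k := k) d) {f | f.totalDegree ≤ d} := by
  intro f hf g hg h
  rw [← aeval_cons_one_X_degHomogenize (R := R) hf, ← aeval_cons_one_X_degHomogenize (R := R) hg, h]

/-- **`f♯d(t, y) = Σ_{e ≤ d} t^{d-e} f^{(e)}(y)`** (values). [cite: BergEtAl2024, Remark 1.3, p.5 (PDF p.6)] -/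
theorem eval_cons_degHomogenize (d : ℕ) (f : MvPolynomial (Fin k) R) (t : R) (y : Fin k → R) :
    eval (Fin.cons t y : Fin (k + 1) → R) (degHomogenize d f) =
      ∑ e ∈ Finset.range (d + 1), t ^ (d - e) * eval y (homogeneousComponent e f) := by
  rw [degHomogenize, map_sum]
  refine Finset.sum_congr rfl fun e _ => ?_
  rw [map_mul, map_pow, eval_X, Fin.cons_zero, eval_rename]
  have : ((Fin.cons t y : Fin (k + 1) → R) ∘ Fin.succ) = y := funext fun i => Fin.cons_succ _ _ i
  rw [this]

/-- **The printed definition `f♯d(x₀, x) = x₀^d · f(x₁/x₀, …, x_k/x₀)`**, at every point with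
`x₀ = t ≠ 0` of a field (`d ≥ deg f`). [cite: BergEtAl2024, Remark 1.3, p.5 (PDF p.6)]
locator: paper:arxiv-2411.03444 p0006.txt:L37–L38 -/
theorem eval_cons_degHomogenize_eq_pow_mul {K : Type*} [Field K] {d : ℕ}
    {f : MvPolynomial (Fin k) K} (hf : f.totalDegree ≤ d) {t : K} (ht : t ≠ 0) (y : Fin k → K) :
    eval (Fin.cons t y : Fin (k + 1) → K) (degHomogenize d f) = t ^ d * eval (t⁻¹ • y) f := by
  rw [eval_cons_degHomogenize, eval_smul_eq_sum_homogeneousComponent, Finset.mul_sum,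
    Finset.sum_subset (Finset.range_subset_range.mpr (Nat.succ_le_succ hf)) (fun e _ he => by
      rw [homogeneousComponent_eq_zero e f (by have := Finset.mem_range.not.mp he; omega),
        map_zero, mul_zero, mul_zero])]
  refine Finset.sum_congr rfl fun e he => ?_
  have he' : e ≤ d := Nat.lt_succ_iff.mp (Finset.mem_range.mp he)
  rw [pow_sub₀ t ht he', ← inv_pow, mul_assoc]

end Poly

/-! ### The circuit bound: `f♯d` by interpolation over `d + 1` rescaled copies of `f` -/

section Circuit

variable {k : ℕ}

/-- Rescaling the variables and moving them to `x₁, …, x_k`: for `φ` homogeneous of degree `n`,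
`φ(a x_{succ ·}) = a^n · φ(x_{succ ·})`. [cite: BergEtAl2024, Remark 1.3, p.5 (PDF p.6)] -/
theorem aeval_C_mul_X_succ_of_isHomogeneous {R : Type*} [CommSemiring R]
    {φ : MvPolynomial (Fin k) R} {n : ℕ} (hφ : φ.IsHomogeneous n) (a : R) :
    aeval (fun v => C a * X (Fin.succ v) : Fin k → MvPolynomial (Fin (k + 1)) R) φ =
      a ^ n • rename Fin.succ φ := by
  have h : (fun v => C a * X (Fin.succ v) : Fin k → MvPolynomial (Fin (k + 1)) R) =
      fun v => rename Fin.succ (C a * X v) := funext fun v => by rw [map_mul, rename_C, rename_X]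
  rw [h, ← comp_aeval, AlgHom.comp_apply, aeval_C_mul_X_of_isHomogeneous hφ, map_smul]

/-- **`f(a x) = Σ_{e ≤ D} a^e f^{(e)}(x)`** for any `D ≥ deg f`, in the variables `x₁, …, x_k`.
[cite: BergEtAl2024, Remark 1.3, p.5 (PDF p.6)] -/
theorem aeval_C_mul_X_succ_eq_sum {R : Type*} [CommSemiring R] (f : MvPolynomial (Fin k) R)
    {D : ℕ} (hD : f.totalDegree ≤ D) (a : R) :
    aeval (fun v => C a * X (Fin.succ v) : Fin k → MvPolynomial (Fin (k + 1)) R) f =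
      ∑ e ∈ Finset.range (D + 1), a ^ e • rename Fin.succ (homogeneousComponent e f) := by
  conv_lhs => rw [← sum_range_homogeneousComponent_of_le f hD, map_sum]
  exact Finset.sum_congr rfl fun e _ =>
    aeval_C_mul_X_succ_of_isHomogeneous (homogeneousComponent_isHomogeneous e f) a

/-- The interpolation polynomial in `x₀` attached to the node `j`:
`μ_j(x₀) = Σ_{e ≤ d} (V⁻¹)_{e j} x₀^{d - e}`, `V` the Vandermonde matrix of the nodes.
[cite: BergEtAl2024, Remark 1.3, p.5 (PDF p.6)] locator: paper:arxiv-2411.03444 p0006.txt:L39–L42 -/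
def interpWeight (d : ℕ) (x : Fin (d + 1) → ℂ) (j : Fin (d + 1)) : MvPolynomial (Fin (k + 1)) ℂ :=
  ∑ e : Fin (d + 1), (Matrix.vandermonde x)⁻¹ e j • X 0 ^ (d - (e : ℕ))

/-- **`f♯d` from `d + 1` rescaled copies of `f`** ("extracting the homogeneous parts of `f` via
interpolation", then powers of `x₀`, products and the final sum, regrouped per node):
`f♯d = Σ_j μ_j(x₀) · f(λ_j x)` for distinct nodes `λ₀, …, λ_d` and `d ≥ deg f`.
[cite: BergEtAl2024, Remark 1.3, p.5 (PDF p.6)] locator: paper:arxiv-2411.03444 p0006.txt:L39–L42 -/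
theorem degHomogenize_eq_sum_interpolation {d : ℕ} (f : MvPolynomial (Fin k) ℂ)
    (hf : f.totalDegree ≤ d) (x : Fin (d + 1) → ℂ) (hx : Function.Injective x) :
    degHomogenize d f =
      ∑ j : Fin (d + 1), interpWeight d x j *
        aeval (fun v => C (x j) * X (Fin.succ v) : Fin k → MvPolynomial (Fin (k + 1)) ℂ) f := by
  -- abbreviations: `P e = x₀^{d-e}`, `Q e = f^{(e)}(x_{succ ·})`
  set P : Fin (d + 1) → MvPolynomial (Fin (k + 1)) ℂ := fun e => X 0 ^ (d - (e : ℕ)) with hP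
  set Q : Fin (d + 1) → MvPolynomial (Fin (k + 1)) ℂ :=
    fun e => rename Fin.succ (homogeneousComponent e f) with hQ
  have hL : degHomogenize d f = ∑ e : Fin (d + 1), P e * Q e := by
    rw [degHomogenize, Finset.sum_range]
  have hR : ∀ j : Fin (d + 1),
      aeval (fun v => C (x j) * X (Fin.succ v) : Fin k → MvPolynomial (Fin (k + 1)) ℂ) f =
        ∑ m : Fin (d + 1), x j ^ (m : ℕ) • Q m := fun j => by
    rw [aeval_C_mul_X_succ_eq_sum f hf, Finset.sum_range]
  simp_rw [hR, interpWeight]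
  calc degHomogenize d f = ∑ e : Fin (d + 1), P e * Q e := hL
    _ = ∑ e : Fin (d + 1), ∑ m : Fin (d + 1),
          (∑ j : Fin (d + 1), (Matrix.vandermonde x)⁻¹ e j * x j ^ (m : ℕ)) • (P e * Q m) := by
        refine Finset.sum_congr rfl fun e _ => ?_
        simp_rw [vandermonde_inv_mul_pow x hx e]
        rw [Finset.sum_eq_single e (fun m _ hm => by rw [if_neg (Ne.symm hm), zero_smul])
          (fun h => absurd (Finset.mem_univ e) h), if_pos rfl, one_smul]
    _ = ∑ e : Fin (d + 1), ∑ m : Fin (d + 1), ∑ j : Fin (d + 1),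
          ((Matrix.vandermonde x)⁻¹ e j * x j ^ (m : ℕ)) • (P e * Q m) := by
        simp_rw [Finset.sum_smul]
    _ = ∑ e : Fin (d + 1), ∑ j : Fin (d + 1), ∑ m : Fin (d + 1),
          ((Matrix.vandermonde x)⁻¹ e j * x j ^ (m : ℕ)) • (P e * Q m) :=
        Finset.sum_congr rfl fun e _ => Finset.sum_comm
    _ = ∑ j : Fin (d + 1), ∑ e : Fin (d + 1), ∑ m : Fin (d + 1),
          ((Matrix.vandermonde x)⁻¹ e j * x j ^ (m : ℕ)) • (P e * Q m) := Finset.sum_comm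
    _ = ∑ j : Fin (d + 1), (∑ e : Fin (d + 1), (Matrix.vandermonde x)⁻¹ e j • P e) *
          ∑ m : Fin (d + 1), x j ^ (m : ℕ) • Q m := by
        refine Finset.sum_congr rfl fun j _ => ?_
        rw [Finset.sum_mul_sum]
        refine Finset.sum_congr rfl fun e _ => Finset.sum_congr rfl fun m _ => ?_
        rw [smul_mul_smul_comm]

/-- **Horner**: a univariate polynomial of degree `≤ n` in one of the variables, written with
descending powers `Σ_{e ≤ n} a_e x^{n-e}`, costs at most `2n` gates (`n` products, `n`
additions; the gate count used for the interpolation polynomials `μ_j(x₀)` of Remark 1.3).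
[cite: BergEtAl2024, Remark 1.3, p.5 (PDF p.6)] -/
theorem complexity_sum_smul_X_pow_sub_le {R : Type*} [CommSemiring R] {σ : Type*} (v : σ) :
    ∀ (n : ℕ) (a : Fin (n + 1) → R),
      complexity (∑ e : Fin (n + 1), a e • (X v : MvPolynomial σ R) ^ (n - (e : ℕ))) ≤ 2 * n := by
  intro n
  induction n with
  | zero =>
    intro a
    have h : ∑ e : Fin (0 + 1), a e • (X v : MvPolynomial σ R) ^ (0 - (e : ℕ)) = C (a 0) := by
      rw [Fin.sum_univ_one]
      simp [smul_eq_C_mul]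
    rw [h, complexity_C_holds]
  | succ n ih =>
    intro a
    have hsplit : ∑ e : Fin (n + 2), a e • (X v : MvPolynomial σ R) ^ (n + 1 - (e : ℕ)) =
        X v * (∑ e : Fin (n + 1), a (Fin.castSucc e) • (X v : MvPolynomial σ R) ^ (n - (e : ℕ))) +
          C (a (Fin.last (n + 1))) := by
      rw [Fin.sum_univ_castSucc, Finset.mul_sum]
      congr 1
      · refine Finset.sum_congr rfl fun e _ => ?_
        rw [Fin.val_castSucc, mul_smul_comm, ← pow_succ',
          show n - (e : ℕ) + 1 = n + 1 - (e : ℕ) by have := e.2; omega]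
      · rw [Fin.val_last, Nat.sub_self, pow_zero, smul_eq_C_mul, mul_one]
    rw [hsplit]
    calc complexity (X v * (∑ e : Fin (n + 1), a (Fin.castSucc e) •
            (X v : MvPolynomial σ R) ^ (n - (e : ℕ))) + C (a (Fin.last (n + 1))))
        ≤ complexity (X v * ∑ e : Fin (n + 1), a (Fin.castSucc e) •
            (X v : MvPolynomial σ R) ^ (n - (e : ℕ))) +
            complexity (C (a (Fin.last (n + 1))) : MvPolynomial σ R) + 1 :=
          complexity_add_le_holds _ _
      _ ≤ (complexity (X v : MvPolynomial σ R) + complexity (∑ e : Fin (n + 1),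
            a (Fin.castSucc e) • (X v : MvPolynomial σ R) ^ (n - (e : ℕ))) + 1) + 0 + 1 := by
          gcongr
          · exact complexity_mul_le_holds _ _
          · exact (complexity_C_holds _).le
      _ ≤ (0 + 2 * n + 1) + 0 + 1 := by
          gcongr
          · exact (complexity_X_holds v).le
          · exact ih _
      _ = 2 * (n + 1) := by ring

/-- The interpolation polynomial `μ_j(x₀)` costs at most `2d` gates (Horner).
[cite: BergEtAl2024, Remark 1.3, p.5 (PDF p.6)] locator: paper:arxiv-2411.03444 p0006.txt:L40–L41 -/
theorem complexity_interpWeight_le (d : ℕ) (x : Fin (d + 1) → ℂ) (j : Fin (d + 1)) :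
    complexity (interpWeight (k := k) d x j) ≤ 2 * d :=
  complexity_sum_smul_X_pow_sub_le (0 : Fin (k + 1)) d fun e => (Matrix.vandermonde x)⁻¹ e j

/-- A rescaled copy `f(λ x_{succ ·})` costs at most `L(f) + k` gates (substitution is free up to the
`k` input rescalings; Bürgisser Rem. 2.7). [cite: BergEtAl2024, Remark 1.3, p.5 (PDF p.6)] -/
theorem complexity_aeval_C_mul_X_succ_le (f : MvPolynomial (Fin k) ℂ) (a : ℂ) :
    complexity (aeval (fun v => C a * X (Fin.succ v) : Fin k → MvPolynomial (Fin (k + 1)) ℂ) f) ≤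
      complexity f + k := by
  refine (complexity_aeval_le f _).trans (Nat.add_le_add_left ?_ _)
  calc ∑ v : Fin k, complexity (C a * X (Fin.succ v) : MvPolynomial (Fin (k + 1)) ℂ)
      ≤ ∑ _v : Fin k, 1 := Finset.sum_le_sum fun v _ =>
        (complexity_mul_le_holds _ _).trans (by
          rw [complexity_C_holds, complexity_X_holds])
    _ = k := by simp

/-- **Remark 1.3, the circuit bound** ("if `f` has an algebraic circuit of size `s`, then `f♯d` has
an algebraic circuit of size at most `O(sd)`"), for the tree's fan-in-two gate count `L`:
`L(f♯d) ≤ (d + 1) · (L(f) + k + 2d + 2)` (`d ≥ deg f`). Per node: one rescaled copy of `f`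
(`L(f) + k`), a Horner evaluation of `μ_j` (`2d`), one product and one addition.
[cite: BergEtAl2024, Remark 1.3, p.5 (PDF p.6)] locator: paper:arxiv-2411.03444 p0006.txt:L38–L42 -/
theorem complexity_degHomogenize_le {d : ℕ} (f : MvPolynomial (Fin k) ℂ) (hf : f.totalDegree ≤ d) :
    complexity (degHomogenize d f) ≤ (d + 1) * (complexity f + k + 2 * d + 2) := by
  rw [degHomogenize_eq_sum_interpolation f hf _ (nodes_injective d)]
  refine (complexity_finset_sum_le _ _).trans ?_
  have hterm : ∀ j : Fin (d + 1),
      complexity (interpWeight (k := k) d (fun j : Fin (d + 1) => ((j : ℕ) : ℂ) + 1) j *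
        aeval (fun v => C ((((j : ℕ) : ℂ) + 1)) * X (Fin.succ v) :
          Fin k → MvPolynomial (Fin (k + 1)) ℂ) f) ≤ complexity f + k + 2 * d + 1 := fun j =>
    calc _ ≤ complexity (interpWeight (k := k) d (fun j : Fin (d + 1) => ((j : ℕ) : ℂ) + 1) j) +
          complexity (aeval (fun v => C ((((j : ℕ) : ℂ) + 1)) * X (Fin.succ v) :
            Fin k → MvPolynomial (Fin (k + 1)) ℂ) f) + 1 := complexity_mul_le_holds _ _
      _ ≤ 2 * d + (complexity f + k) + 1 :=
          Nat.add_le_add_right (Nat.add_le_add (complexity_interpWeight_le _ _ _)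
            (complexity_aeval_C_mul_X_succ_le _ _)) 1
      _ = complexity f + k + 2 * d + 1 := by ring
  calc ∑ j : Fin (d + 1), complexity (interpWeight (k := k) d
          (fun j : Fin (d + 1) => ((j : ℕ) : ℂ) + 1) j *
          aeval (fun v => C ((((j : ℕ) : ℂ) + 1)) * X (Fin.succ v) :
            Fin k → MvPolynomial (Fin (k + 1)) ℂ) f) + (Finset.univ : Finset (Fin (d + 1))).card
      ≤ ∑ _j : Fin (d + 1), (complexity f + k + 2 * d + 1) + (d + 1) := by
        gcongr with j
        · exact hterm j
        · rw [Finset.card_univ, Fintype.card_fin]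
    _ = (d + 1) * (complexity f + k + 2 * d + 2) := by
        rw [Finset.sum_const, Finset.card_univ, Fintype.card_fin, smul_eq_mul]; ring

/-! #### The same bound for the paper's size `cc` (affine-linear inputs free) -/

/-- **Submultiplicativity of `cc`**: `cc(F · G) ≤ cc(F) + cc(G) + 1` (juxtapose optimal
presentations on disjoint variable sets and multiply the outputs).
[cite: BergEtAl2024, §2.1, p.6 (PDF p.7)] -/
theorem affComplexity_mul_le {τ : Type*} [Fintype τ] (F G : MvPolynomial τ ℂ) :
    affComplexity (F * G) ≤ affComplexity F + affComplexity G + 1 := by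
  obtain ⟨m₁, G₁, ℓ₁, hℓ₁, hF₁, hc₁⟩ := exists_presentation_affComplexity F
  obtain ⟨m₂, G₂, ℓ₂, hℓ₂, hF₂, hc₂⟩ := exists_presentation_affComplexity G
  have hpres : aeval (Fin.append ℓ₁ ℓ₂)
      (rename (Fin.castAdd m₂) G₁ * rename (Fin.natAdd m₁) G₂) = F * G := by
    rw [map_mul, aeval_rename, aeval_rename]
    have h1 : (Fin.append ℓ₁ ℓ₂ ∘ Fin.castAdd m₂ : Fin m₁ → MvPolynomial τ ℂ) = ℓ₁ :=
      funext fun i => Fin.append_left ℓ₁ ℓ₂ i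
    have h2 : (Fin.append ℓ₁ ℓ₂ ∘ Fin.natAdd m₁ : Fin m₂ → MvPolynomial τ ℂ) = ℓ₂ :=
      funext fun i => Fin.append_right ℓ₁ ℓ₂ i
    rw [h1, h2, hF₁, hF₂]
  refine (affComplexity_le_of_presentation _ _ (fun i => ?_) hpres).trans ?_
  · refine Fin.addCases (fun j => ?_) (fun j => ?_) i
    · rw [Fin.append_left]; exact hℓ₁ j
    · rw [Fin.append_right]; exact hℓ₂ j
  · refine (complexity_mul_le_holds _ _).trans ?_
    rw [← hc₁, ← hc₂]
    exact Nat.add_le_add_right (Nat.add_le_add (complexity_rename_le_holds' _ _)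
      (complexity_rename_le_holds' _ _)) 1

/-- **Sums**: `cc(Σ_{j ∈ T} F_j) ≤ Σ_{j ∈ T} (cc(F_j) + 1)`. [cite: BergEtAl2024, §2.1, p.6 (PDF p.7)] -/
theorem affComplexity_sum_le {τ : Type*} [Fintype τ] {ι : Type*} (T : Finset ι)
    (F : ι → MvPolynomial τ ℂ) :
    affComplexity (∑ j ∈ T, F j) ≤ ∑ j ∈ T, (affComplexity (F j) + 1) := by
  classical
  induction T using Finset.induction_on with
  | empty =>
    rw [Finset.sum_empty, Finset.sum_empty]
    have h0 : (0 : MvPolynomial τ ℂ).totalDegree ≤ 1 := by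
      rw [totalDegree_zero]; exact Nat.zero_le _
    exact (affComplexity_eq_zero_of_totalDegree_le_one h0).le
  | insert j T hj ih =>
    rw [Finset.sum_insert hj, Finset.sum_insert hj]
    refine (affComplexity_add_le _ _).trans ?_
    omega

/-- **Remark 1.3, the circuit bound for the paper's size `cc`** (affine-linear input gates free,
§2.1): `cc(f♯d) ≤ (d + 1) · (cc(f) + 2d + 2)` (`d ≥ deg f`) — the printed `s(d + 1)` for the
rescaled copies (input rescalings are free for `cc`) plus, per node, the Horner gates of `μ_j`,
one product and one addition. [cite: BergEtAl2024, Remark 1.3, p.5 (PDF p.6)]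
locator: paper:arxiv-2411.03444 p0006.txt:L38–L42 -/
theorem affComplexity_degHomogenize_le {d : ℕ} (f : MvPolynomial (Fin k) ℂ)
    (hf : f.totalDegree ≤ d) :
    affComplexity (degHomogenize d f) ≤ (d + 1) * (affComplexity f + 2 * d + 2) := by
  rw [degHomogenize_eq_sum_interpolation f hf _ (nodes_injective d)]
  refine (affComplexity_sum_le _ _).trans ?_
  have hterm : ∀ j : Fin (d + 1),
      affComplexity (interpWeight (k := k) d (fun j : Fin (d + 1) => ((j : ℕ) : ℂ) + 1) j *
        aeval (fun v => C ((((j : ℕ) : ℂ) + 1)) * X (Fin.succ v) :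
          Fin k → MvPolynomial (Fin (k + 1)) ℂ) f) + 1 ≤ affComplexity f + 2 * d + 2 := fun j => by
    have h1 : affComplexity (interpWeight (k := k) d (fun j : Fin (d + 1) => ((j : ℕ) : ℂ) + 1) j)
        ≤ 2 * d :=
      (affComplexity_le_complexity _).trans (complexity_interpWeight_le _ _ _)
    have h2 : affComplexity (aeval (fun v => C ((((j : ℕ) : ℂ) + 1)) * X (Fin.succ v) :
        Fin k → MvPolynomial (Fin (k + 1)) ℂ) f) ≤ affComplexity f :=
      affComplexity_aeval_le_of_forall_le_one f fun v =>
        (isHomogeneous_C_mul_X _ _).totalDegree_le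
    have h3 := affComplexity_mul_le
      (interpWeight (k := k) d (fun j : Fin (d + 1) => ((j : ℕ) : ℂ) + 1) j)
      (aeval (fun v => C ((((j : ℕ) : ℂ) + 1)) * X (Fin.succ v) :
        Fin k → MvPolynomial (Fin (k + 1)) ℂ) f)
    omega
  calc ∑ j : Fin (d + 1), (affComplexity (interpWeight (k := k) d
          (fun j : Fin (d + 1) => ((j : ℕ) : ℂ) + 1) j *
          aeval (fun v => C ((((j : ℕ) : ℂ) + 1)) * X (Fin.succ v) :
            Fin k → MvPolynomial (Fin (k + 1)) ℂ) f) + 1)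
      ≤ ∑ _j : Fin (d + 1), (affComplexity f + 2 * d + 2) := Finset.sum_le_sum fun j _ => hterm j
    _ = (d + 1) * (affComplexity f + 2 * d + 2) := by
        rw [Finset.sum_const, Finset.card_univ, Fintype.card_fin, smul_eq_mul]

end Circuit

/-! ### `Δ♯d`: the lift of a metapolynomial on `ℂ[x₁,…,x_k]` to format `(·, d, k + 1)` -/

section Meta

variable {F : Type*} [CommSemiring F] {k : ℕ}

/-- The exponent `(d - |i|, i)` has degree `d` when `|i| ≤ d`. [cite: BergEtAl2024, Remark 1.3, p.5 (PDF p.6)] -/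
theorem cons_sub_mem_degMonomials {d : ℕ} {i : Fin k →₀ ℕ} (hi : i.degree ≤ d) :
    Finsupp.cons (d - i.degree) i ∈ degMonomials (Fin (k + 1)) d := by
  rw [mem_degMonomials_iff, degree_cons, Nat.sub_add_cancel hi]

/-- The substitution of metavariables defining `Δ♯d`: `c_i ↦ c_{(d - |i|, i)}` if `|i| ≤ d`, and
`c_i ↦ 0` if `|i| > d`. [cite: BergEtAl2024, Remark 1.3, p.5 (PDF p.6)]
locator: paper:arxiv-2411.03444 p0006.txt:L44–L46 -/
def metaVarLift (d : ℕ) (M : Set (Fin k →₀ ℕ)) (i : M) :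
    MvPolynomial (DegIdx (Fin (k + 1)) d) F :=
  if h : (i : Fin k →₀ ℕ).degree ≤ d then
    X ⟨Finsupp.cons (d - (i : Fin k →₀ ℕ).degree) (i : Fin k →₀ ℕ), cons_sub_mem_degMonomials h⟩
  else 0

/-- **`Δ♯d`** for a metapolynomial `Δ ∈ F[c_i : i ∈ M]` "that does not involve `x₀`" (`M` any set
of exponents of monomials in `x₁, …, x_k`; `Δ(f) = eval (coeffVector M f) Δ`): "replace every
metavariable `c_i` with `c_{i + (d - |i|, 0, …, 0)}`, and set every metavariable `c_i` with
`|i| > d` to zero" — a metapolynomial on the forms of degree `d` in `x₀, …, x_k`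
(`Δ♯d(g) = eval (formCoeff d g) (Δ♯d)`). [cite: BergEtAl2024, Remark 1.3, p.5 (PDF p.6)]
locator: paper:arxiv-2411.03444 p0006.txt:L44–L46 -/
def metaHomogenize (d : ℕ) {M : Set (Fin k →₀ ℕ)} (Δ : MvPolynomial M F) :
    MvPolynomial (DegIdx (Fin (k + 1)) d) F :=
  aeval (metaVarLift (F := F) d M) Δ

/-- Unfolding: `Δ♯d = aeval metaVarLift Δ`. [cite: BergEtAl2024, Remark 1.3, p.5 (PDF p.6)] -/
theorem metaHomogenize_def (d : ℕ) {M : Set (Fin k →₀ ℕ)} (Δ : MvPolynomial M F) :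
    metaHomogenize d Δ = aeval (metaVarLift (F := F) d M) Δ :=
  rfl

/-- On a metavariable of degree `≤ d`: `c_i♯d = c_{(d - |i|, i)}`. [cite: BergEtAl2024, Remark 1.3, p.5 (PDF p.6)] -/
theorem metaHomogenize_X_of_le (d : ℕ) {M : Set (Fin k →₀ ℕ)} (i : M)
    (hi : (i : Fin k →₀ ℕ).degree ≤ d) :
    metaHomogenize (F := F) d (X i : MvPolynomial M F) =
      X ⟨Finsupp.cons (d - (i : Fin k →₀ ℕ).degree) (i : Fin k →₀ ℕ),
        cons_sub_mem_degMonomials hi⟩ := by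
  rw [metaHomogenize, aeval_X, metaVarLift, dif_pos hi]

/-- On a metavariable of degree `> d`: `c_i♯d = 0`. [cite: BergEtAl2024, Remark 1.3, p.5 (PDF p.6)] -/
theorem metaHomogenize_X_of_lt (d : ℕ) {M : Set (Fin k →₀ ℕ)} (i : M)
    (hi : d < (i : Fin k →₀ ℕ).degree) :
    metaHomogenize (F := F) d (X i : MvPolynomial M F) = 0 := by
  rw [metaHomogenize, aeval_X, metaVarLift, dif_neg (not_le.mpr hi)]

/-- `Δ ↦ Δ♯d` is an `F`-algebra map; in particular additive … [cite: BergEtAl2024, Remark 1.3, p.5 (PDF p.6)] -/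
theorem metaHomogenize_add (d : ℕ) {M : Set (Fin k →₀ ℕ)} (Δ Γ : MvPolynomial M F) :
    metaHomogenize d (Δ + Γ) = metaHomogenize d Δ + metaHomogenize d Γ :=
  map_add _ _ _

/-- … and multiplicative. [cite: BergEtAl2024, Remark 1.3, p.5 (PDF p.6)] -/
theorem metaHomogenize_mul (d : ℕ) {M : Set (Fin k →₀ ℕ)} (Δ Γ : MvPolynomial M F) :
    metaHomogenize d (Δ * Γ) = metaHomogenize d Δ * metaHomogenize d Γ :=
  map_mul _ _ _

/-- Each `c_i♯d` is a variable or `0`, hence homogeneous of degree `1`. [folklore] -/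
private theorem isHomogeneous_metaVarLift (d : ℕ) (M : Set (Fin k →₀ ℕ)) (i : M) :
    (metaVarLift (F := F) d M i).IsHomogeneous 1 := by
  unfold metaVarLift
  split_ifs
  · exact isHomogeneous_X _ _
  · exact isHomogeneous_zero _ _ _

/-- **`Δ♯d` is homogeneous of the same degree as `Δ`** (a homogeneous metapolynomial of format
`(δ, ·, k)` lifts to one of format `(δ, d, k + 1)`). [cite: BergEtAl2024, Remark 1.3, p.5 (PDF p.6)]
locator: paper:arxiv-2411.03444 p0006.txt:L44–L48 -/
theorem isHomogeneous_metaHomogenize (d : ℕ) {M : Set (Fin k →₀ ℕ)} {Δ : MvPolynomial M F} {δ : ℕ}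
    (hΔ : Δ.IsHomogeneous δ) : (metaHomogenize d Δ).IsHomogeneous δ := by
  have h := hΔ.aeval (metaVarLift (F := F) d M) (isHomogeneous_metaVarLift d M)
  rwa [one_mul] at h

/-- `eval x (aeval φ Δ) = eval (eval x ∘ φ) Δ`. [folklore] -/
private theorem eval_aeval_eq_eval {F : Type*} [CommSemiring F] {τ υ : Type*} (x : υ → F)
    (φ : τ → MvPolynomial υ F) (Δ : MvPolynomial τ F) :
    eval x (aeval φ Δ) = eval (fun i => eval x (φ i)) Δ := by
  rw [aeval_def, eval₂_comp_left]
  have h1 : (eval x).comp (algebraMap F (MvPolynomial υ F)) = RingHom.id F := by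
    ext r; simp
  rw [h1]
  rfl

/-- The evaluation point of `Δ♯d` at `f♯d` pulls back to the coefficient vector of `f` on `M`
(`d ≥ deg f`). [cite: BergEtAl2024, Remark 1.3, p.5 (PDF p.6)] -/
theorem eval_formCoeff_degHomogenize_metaVarLift {F : Type*} [CommRing F] (d : ℕ)
    (M : Set (Fin k →₀ ℕ)) {f : MvPolynomial (Fin k) F} (hf : f.totalDegree ≤ d) (i : M) :
    eval (formCoeff d (degHomogenize d f)) (metaVarLift (F := F) d M i) =
      coeffVector M f i := by
  unfold metaVarLift
  split_ifs with h
  · rw [eval_X, formCoeff_apply, coeffVector_apply, coeff_cons_sub_degHomogenize d f h]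
  · rw [map_zero, coeffVector_apply]
    symm
    refine coeff_eq_zero_of_totalDegree_lt ?_
    rw [← Finsupp.degree_apply]
    omega

/-- **Remark 1.3: `Δ♯d(f♯d) = Δ(f)` provided `d ≥ deg f`** — evaluating the lifted metapolynomial
at the homogenisation is evaluating `Δ` at (the `M`-coefficient vector of) `f`.
[cite: BergEtAl2024, Remark 1.3, p.5 (PDF p.6)] locator: paper:arxiv-2411.03444 p0006.txt:L46–L47 -/
theorem eval_metaHomogenize_degHomogenize {F : Type*} [CommRing F] (d : ℕ) {M : Set (Fin k →₀ ℕ)}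
    (Δ : MvPolynomial M F) {f : MvPolynomial (Fin k) F} (hf : f.totalDegree ≤ d) :
    eval (formCoeff d (degHomogenize d f)) (metaHomogenize d Δ) = eval (coeffVector M f) Δ := by
  rw [metaHomogenize, eval_aeval_eq_eval]
  have h : (fun i => eval (formCoeff d (degHomogenize d f)) (metaVarLift (F := F) d M i)) =
      coeffVector M f := funext fun i => eval_formCoeff_degHomogenize_metaVarLift d M hf i
  rw [h]

/-- When `M` only has exponents of degree `≤ d` (e.g. the FSV frame `degLEMonomials n` with
`d = n`), no metavariable is killed and `Δ♯d(f♯d) = Δ(f)` holds for EVERY `f` (the coefficients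
of `f` above degree `d` are never consulted). [cite: BergEtAl2024, Remark 1.3, p.5 (PDF p.6)] -/
theorem eval_metaHomogenize_degHomogenize_of_subset {F : Type*} [CommRing F] (d : ℕ)
    {M : Set (Fin k →₀ ℕ)} (hM : ∀ i ∈ M, Finsupp.degree i ≤ d) (Δ : MvPolynomial M F)
    (f : MvPolynomial (Fin k) F) :
    eval (formCoeff d (degHomogenize d f)) (metaHomogenize d Δ) = eval (coeffVector M f) Δ := by
  rw [metaHomogenize, eval_aeval_eq_eval]
  have h : (fun i => eval (formCoeff d (degHomogenize d f)) (metaVarLift (F := F) d M i)) =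
      coeffVector M f := funext fun i => by
    have hi : metaVarLift (F := F) d M i = X ⟨Finsupp.cons (d - (i : Fin k →₀ ℕ).degree)
        (i : Fin k →₀ ℕ), cons_sub_mem_degMonomials (hM i i.2)⟩ := dif_pos (hM i i.2)
    rw [hi, eval_X, formCoeff_apply, coeffVector_apply, coeff_cons_sub_degHomogenize d f (hM i i.2)]
  rw [h]

/-- When `M ⊆ {|i| ≤ d}`, `Δ ↦ Δ♯d` is the renaming of metavariables along the INJECTIVE map
`i ↦ (d - |i|, i)`. [cite: BergEtAl2024, Remark 1.3, p.5 (PDF p.6)] -/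
theorem metaHomogenize_eq_rename_of_subset (d : ℕ) {M : Set (Fin k →₀ ℕ)}
    (hM : ∀ i ∈ M, Finsupp.degree i ≤ d) (Δ : MvPolynomial M F) :
    metaHomogenize d Δ = rename (fun i : M => (⟨Finsupp.cons (d - Finsupp.degree (i : Fin k →₀ ℕ))
      (i : Fin k →₀ ℕ), cons_sub_mem_degMonomials (hM i i.2)⟩ : DegIdx (Fin (k + 1)) d)) Δ := by
  have h : metaVarLift (F := F) d M = fun i : M => X (⟨Finsupp.cons (d - Finsupp.degree
      (i : Fin k →₀ ℕ)) (i : Fin k →₀ ℕ), cons_sub_mem_degMonomials (hM i i.2)⟩ :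
        DegIdx (Fin (k + 1)) d) := funext fun i => dif_pos (hM i i.2)
  rw [metaHomogenize, h]
  exact (DFunLike.congr_fun (rename_eq_aeval (R := F) _) Δ).symm

/-- The exponent map `i ↦ (d - |i|, i)` is injective (its left inverse is `Finsupp.tail`).
[cite: BergEtAl2024, Remark 1.3, p.5 (PDF p.6)] -/
theorem cons_sub_injective (d : ℕ) {M : Set (Fin k →₀ ℕ)} (hM : ∀ i ∈ M, Finsupp.degree i ≤ d) :
    Function.Injective (fun i : M => (⟨Finsupp.cons (d - Finsupp.degree (i : Fin k →₀ ℕ))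
      (i : Fin k →₀ ℕ), cons_sub_mem_degMonomials (hM i i.2)⟩ : DegIdx (Fin (k + 1)) d)) := by
  intro i j h
  have h' := congrArg (fun m : DegIdx (Fin (k + 1)) d => Finsupp.tail (m : Fin (k + 1) →₀ ℕ)) h
  simp only [Finsupp.tail_cons] at h'
  exact Subtype.ext h'

/-- **`Δ ↦ Δ♯d` is injective when `M ⊆ {|i| ≤ d}`**; in particular `Δ ≠ 0 ⇒ Δ♯d ≠ 0`.
[cite: BergEtAl2024, Remark 1.3, p.5 (PDF p.6)] -/
theorem metaHomogenize_injective (d : ℕ) {M : Set (Fin k →₀ ℕ)}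
    (hM : ∀ i ∈ M, Finsupp.degree i ≤ d) :
    Function.Injective (metaHomogenize (F := F) (M := M) d) := by
  intro Δ Γ h
  rw [metaHomogenize_eq_rename_of_subset d hM, metaHomogenize_eq_rename_of_subset d hM] at h
  exact rename_injective _ (cons_sub_injective d hM) h

/-- `Δ ≠ 0 ⇒ Δ♯d ≠ 0` for `M ⊆ {|i| ≤ d}`. [cite: BergEtAl2024, Remark 1.3, p.5 (PDF p.6)] -/
theorem metaHomogenize_ne_zero (d : ℕ) {M : Set (Fin k →₀ ℕ)} (hM : ∀ i ∈ M, Finsupp.degree i ≤ d)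
    {Δ : MvPolynomial M F} (hΔ : Δ ≠ 0) : metaHomogenize d Δ ≠ 0 := fun h =>
  hΔ (metaHomogenize_injective d hM (by rw [h, metaHomogenize, map_zero]))

/-! #### `Δ♯d` is no more complex than `Δ` -/

/-- **`L(Δ♯d) ≤ L(Δ)`**: substituting variables and `0` for variables is free (Bürgisser Rem. 2.7).
[cite: BergEtAl2024, Remark 1.3, p.5 (PDF p.6)] -/
theorem complexity_metaHomogenize_le (d : ℕ) {M : Set (Fin k →₀ ℕ)} [Fintype M]
    (Δ : MvPolynomial M F) : complexity (metaHomogenize d Δ) ≤ complexity Δ := by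
  refine (complexity_aeval_le Δ _).trans ?_
  rw [Finset.sum_eq_zero fun i _ => ?_, Nat.add_zero]
  unfold metaVarLift
  split_ifs
  · exact complexity_X_holds _
  · rw [← C_0]; exact complexity_C_holds (0 : F)

/-- **`cc(Δ♯d) ≤ cc(Δ)`** for the paper's size (the substitution is linear).
[cite: BergEtAl2024, Remark 1.3, p.5 (PDF p.6)] -/
theorem affComplexity_metaHomogenize_le (d : ℕ) {M : Set (Fin k →₀ ℕ)} [Fintype M]
    (Δ : MvPolynomial M ℂ) : affComplexity (metaHomogenize d Δ) ≤ affComplexity Δ :=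
  affComplexity_aeval_le_of_forall_le_one Δ fun i => (isHomogeneous_metaVarLift d M i).totalDegree_le

/-! #### Transfer: "hence we can always assume that `f` is homogeneous" -/

/-- If `Δ` vanishes on (the coefficient vectors of) a class `𝒞` of polynomials of degree `≤ d`,
then `Δ♯d` vanishes on the class of degree-`d` forms `{f♯d : f ∈ 𝒞}`.
[cite: BergEtAl2024, Remark 1.3, p.5 (PDF p.6)] locator: paper:arxiv-2411.03444 p0006.txt:L46–L48 -/
theorem metaHomogenize_vanishes_image {F : Type*} [CommRing F] (d : ℕ) {M : Set (Fin k →₀ ℕ)}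
    {Δ : MvPolynomial M F} {𝒞 : Set (MvPolynomial (Fin k) F)} (h𝒞 : ∀ f ∈ 𝒞, f.totalDegree ≤ d)
    (hΔ : ∀ f ∈ 𝒞, eval (coeffVector M f) Δ = 0) :
    ∀ g ∈ degHomogenize d '' 𝒞, eval (formCoeff d g) (metaHomogenize d Δ) = 0 := by
  rintro _ ⟨f, hf, rfl⟩
  rw [eval_metaHomogenize_degHomogenize d Δ (h𝒞 f hf), hΔ f hf]

/-- If `Δ(f) ≠ 0` (`d ≥ deg f`) then `Δ♯d(f♯d) ≠ 0`; in particular `Δ♯d ≠ 0`.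
[cite: BergEtAl2024, Remark 1.3, p.5 (PDF p.6)] locator: paper:arxiv-2411.03444 p0006.txt:L46–L48 -/
theorem eval_metaHomogenize_ne_zero {F : Type*} [CommRing F] (d : ℕ) {M : Set (Fin k →₀ ℕ)}
    {Δ : MvPolynomial M F} {f : MvPolynomial (Fin k) F} (hf : f.totalDegree ≤ d)
    (h : eval (coeffVector M f) Δ ≠ 0) :
    eval (formCoeff d (degHomogenize d f)) (metaHomogenize d Δ) ≠ 0 ∧ metaHomogenize d Δ ≠ 0 := by
  rw [eval_metaHomogenize_degHomogenize d Δ hf]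
  refine ⟨h, fun h0 => h ?_⟩
  rw [← eval_metaHomogenize_degHomogenize d Δ hf, h0, map_zero]

/-- **Remark 1.3 in the natural-proofs frame** (`AlgebraicNaturalProofs.IsNaturalProof`, FSV
Def. 1): a `𝒟`-natural proof `D` against a class `𝒞 ⊆ F[x₁,…,x_k]^{≤ d}` (metavariables `M`) lifts
to the HOMOGENEOUS-format metapolynomial `D♯d` which is a `𝒟'`-natural proof against the class
`f♯d '' 𝒞` of degree-`d` forms in `x₀, …, x_k` — for every distinguisher class `𝒟'` containing
`D♯d` (e.g. cut out by `cc`/`L` bounds, which `♯d` respects: `affComplexity_metaHomogenize_le`,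
`complexity_metaHomogenize_le`). Here the target frame is the full set of degree-`d` exponents, so
`coeffVector` there is the BDGIL24 coefficient point `formCoeff d`.
[cite: BergEtAl2024, Remark 1.3, p.5 (PDF p.6)] locator: paper:arxiv-2411.03444 p0006.txt:L32–L48 -/
theorem isNaturalProof_metaHomogenize {F : Type*} [CommRing F] (d : ℕ) {M : Set (Fin k →₀ ℕ)}
    {𝒞 : Set (MvPolynomial (Fin k) F)} (h𝒞 : ∀ f ∈ 𝒞, f.totalDegree ≤ d)
    {𝒟 : Set (MvPolynomial M F)} {D : MvPolynomial M F} (hD : IsNaturalProof M 𝒞 𝒟 D)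
    {f₀ : MvPolynomial (Fin k) F} (hf₀ : f₀.totalDegree ≤ d) (hDf₀ : eval (coeffVector M f₀) D ≠ 0)
    {𝒟' : Set (MvPolynomial (DegIdx (Fin (k + 1)) d) F)} (hD' : metaHomogenize d D ∈ 𝒟') :
    IsNaturalProof (↑(degMonomials (Fin (k + 1)) d)) (degHomogenize d '' 𝒞) 𝒟'
        (metaHomogenize d D) ∧
      eval (coeffVector (↑(degMonomials (Fin (k + 1)) d)) (degHomogenize d f₀))
        (metaHomogenize d D) ≠ 0 := by
  have hev : ∀ g : MvPolynomial (Fin (k + 1)) F,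
      coeffVector (↑(degMonomials (Fin (k + 1)) d)) g = formCoeff d g := fun g => rfl
  refine ⟨⟨hD', (eval_metaHomogenize_ne_zero d hf₀ hDf₀).2, fun g hg => ?_⟩, ?_⟩
  · rw [hev]
    exact metaHomogenize_vanishes_image d h𝒞 hD.2.2 g hg
  · rw [hev]
    exact (eval_metaHomogenize_ne_zero d hf₀ hDf₀).1

/-- The same transfer with `D♯d ≠ 0` obtained from injectivity instead of a witness: for
`M ⊆ {|i| ≤ d}` (e.g. `degLEMonomials n`, `d = n`) every natural proof lifts, and no degree
hypothesis on `𝒞` is needed. [cite: BergEtAl2024, Remark 1.3, p.5 (PDF p.6)] -/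
theorem isNaturalProof_metaHomogenize_of_subset {F : Type*} [CommRing F] (d : ℕ)
    {M : Set (Fin k →₀ ℕ)} (hM : ∀ i ∈ M, Finsupp.degree i ≤ d)
    {𝒞 : Set (MvPolynomial (Fin k) F)} {𝒟 : Set (MvPolynomial M F)} {D : MvPolynomial M F}
    (hD : IsNaturalProof M 𝒞 𝒟 D) {𝒟' : Set (MvPolynomial (DegIdx (Fin (k + 1)) d) F)}
    (hD' : metaHomogenize d D ∈ 𝒟') :
    IsNaturalProof (↑(degMonomials (Fin (k + 1)) d)) (degHomogenize d '' 𝒞) 𝒟'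
      (metaHomogenize d D) := by
  refine ⟨hD', metaHomogenize_ne_zero d hM hD.2.1, ?_⟩
  rintro _ ⟨f, hf, rfl⟩
  have hev : coeffVector (↑(degMonomials (Fin (k + 1)) d)) (degHomogenize d f) =
      formCoeff d (degHomogenize d f) := rfl
  rw [hev, eval_metaHomogenize_degHomogenize_of_subset d hM D f]
  exact hD.2.2 f hf

end Meta

end BergEtAl2024

end Literature.Barriers.ValiantsHypothesis

end
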